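import Summits.BirchSwinnertonDyer.BirchSwinnertonDyer.Theorems.EisensteinPrimesLcongrSecondLevel
import HarnessLib

/-!
# The single-level door's `lcongr` at EVERY level is decided by the first-order term: for
# `L = u·E + p·M + p^{m+1}·c` with `u` a unit and `μ(E) = 0`, `(L) + (p)^{m+1} = (E) + (p)^{m+1}` holds
# if and only if `M ∈ (E) + (p)^m` — level `m + 1` for `L` IS level `m` for `M` relative to `E`; levels
# are monotone; at every level `≥ 2` the `T`-order obstruction `λ(E) ≤ ord_T(M mod p)` persists (cell
# `bsd-eis`, seat `bsd-line-x2-p2`, D-0154 KEY row 5; route `EisensteinPrimes`, crux 4 `BSDpOnCellC`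
# stmt-BirchSwinnertonDyer-19034 line b1 v10 / crux 3 `MazurMCOnCellB` ∩ non-split; generalises
# `LcongrSecondLevel` (p583318, `m = 1`); memo `HOME/cgshw-MEMO-24.md` §1 (d), §5 — `lcongr` tested at
# `m = 1 … 4`)

HONEST FRAMING (cell `bsd-eis`, run/shared/lean/pub/bsd-eis/): pure commutative algebra of `Λ = ℤ_p⟦T⟧`,
everything PROVED (Mathlib + the tree's `X1.MuLambda` / `X2.KeyCongruence` / `LcongrIffUnitCongruence` /
`LcongrAtLevelOne` / `LcongrSecondLevel` API); nothing booked; X2 stays CONSTRUCTION-SHAPED; no label or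
count moves; BSD is proved for no curve.

## The point

`LcongrSecondLevel` (cgshw g21) decided level two of the door's `lcongr` for `L = u·E + p·M`: it holds
iff `red M ∈ (red E)`. MEMO-24 §5 tests `lcongr` numerically up to `m = 4` and reads «`E` special ⇒ one
level lost at every depth» (1020e1: the depth-`m` member satisfies `lcongr(m − 1)` but not `lcongr(m)`,
`m = 2, 3`). The kernel form of «at every depth» is the RECURSION proved here: `lcongr` at level `m + 1`
for `u·E + p·M (+ p^{m+1}·c)` is EXACTLY the level-`m` congruence `M ∈ (E) + (p^m)` of the first-order
term — so a branch whose first-order term `M` is rigid (a β-branch, `M̄ = L̄(Ξ̄)` fixed) loses at level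
`m + 1` precisely what `M` lacks at level `m`, and the defect propagates level by level.

* §1 `lcongr_mono` — `(a) + (p)^n = (b) + (p)^n` ⟹ the same at every `m ≤ n`.
* §2 **`lcongr_succ_iff_mem_span_sup_pow`** — `E ≠ 0`, `μ(E) = 0`, `u` a unit,
  `L = u·E + p·M + p^{m+1}·c` ⟹ (`(L) + (p)^{m+1} = (E) + (p)^{m+1}` ⟺ `M ∈ (E) + (p)^m`); the case
  `c = 0` (`lcongr_succ_iff_mem_span_sup_pow'`); `m = 0` recovers «level one is free», `m = 1` recovers
  p583318 §2 (`(E) + (p) ∋ M` ⟺ `red M ∈ (red E)`, `mem_span_sup_span_C_iff_red_mem`).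
* §3 `lam_le_order_red_of_lcongr_add_two` — at any level `≥ 2` the obstruction of p583318 §3 persists:
  `lcongr(m + 2)` ⟹ `λ(E) ≤ ord_T(red M)` (for `red M ≠ 0`).

What this is NOT: not a statement about any `L`-function or modular symbol; `u`, `M`, `c` and the
decomposition are INPUTS; not a proof of `lcongr` for any member, of any main conjecture, or of BSD.

References: [Skinner2016PacificMC] §3.1 (p. 192); [Washington1997] §7.1; [CastellaGrossiSkinner2025]
proof of Thm. 7.2.3 (key congruence).
-/

set_option autoImplicit false
set_option linter.dupNamespace false

noncomputable section

open Literature.NumberTheory.EllipticCurves Summit.BirchSwinnertonDyer.Rank1Residual.X1.MuLambda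
  Summit.BirchSwinnertonDyer.Rank1Residual.X2.KeyCongruence
  Summit.BirchSwinnertonDyer.Rank1Residual.Supersingular
  Summit.BirchSwinnertonDyer.BirchSwinnertonDyer.Theorems.LcongrIffUnitCongruence
  Summit.BirchSwinnertonDyer.BirchSwinnertonDyer.Theorems.LcongrAtLevelOne
  Summit.BirchSwinnertonDyer.BirchSwinnertonDyer.Theorems.LcongrSecondLevel Summit.BirchSwinnertonDyer.Rank2

namespace Summit.BirchSwinnertonDyer.BirchSwinnertonDyer.Theorems.LcongrHigherLevel

variable {p : ℕ} [Fact p.Prime]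

/-! ## §1. Levels are monotone -/

/-- **`lcongr` is monotone in the level**: `(a) + (p)^n = (b) + (p)^n` and `m ≤ n` give
`(a) + (p)^m = (b) + (p)^m` (join both sides with `(p)^m ⊇ (p)^n`). [folklore] -/
theorem lcongr_mono {a b : IwasawaAlgebra p} {m n : ℕ} (hmn : m ≤ n)
    (h : Ideal.span ({a} : Set (IwasawaAlgebra p)) ⊔
        (Ideal.span {(PowerSeries.C (p : ℤ_[p]) : IwasawaAlgebra p)}) ^ n =
      Ideal.span ({b} : Set (IwasawaAlgebra p)) ⊔
        (Ideal.span {(PowerSeries.C (p : ℤ_[p]) : IwasawaAlgebra p)}) ^ n) :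
    Ideal.span ({a} : Set (IwasawaAlgebra p)) ⊔
        (Ideal.span {(PowerSeries.C (p : ℤ_[p]) : IwasawaAlgebra p)}) ^ m =
      Ideal.span ({b} : Set (IwasawaAlgebra p)) ⊔
        (Ideal.span {(PowerSeries.C (p : ℤ_[p]) : IwasawaAlgebra p)}) ^ m := by
  have hle : (Ideal.span {(PowerSeries.C (p : ℤ_[p]) : IwasawaAlgebra p)}) ^ n ≤
      (Ideal.span {(PowerSeries.C (p : ℤ_[p]) : IwasawaAlgebra p)}) ^ m := Ideal.pow_le_pow_right hmn
  have key : ∀ x : IwasawaAlgebra p,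
      Ideal.span ({x} : Set (IwasawaAlgebra p)) ⊔
          (Ideal.span {(PowerSeries.C (p : ℤ_[p]) : IwasawaAlgebra p)}) ^ m =
        (Ideal.span ({x} : Set (IwasawaAlgebra p)) ⊔
          (Ideal.span {(PowerSeries.C (p : ℤ_[p]) : IwasawaAlgebra p)}) ^ n) ⊔
          (Ideal.span {(PowerSeries.C (p : ℤ_[p]) : IwasawaAlgebra p)}) ^ m := by
    intro x
    rw [sup_assoc, sup_eq_right.mpr hle]
  rw [key a, key b, h]

/-! ## §2. Level `m + 1` for `L` is level `m` for the first-order term -/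

/-- `(E) + (p)^m ∋ M` unfolded: `M = a·E + s·p^m` for some `a, s`. [folklore] -/
theorem mem_span_sup_span_C_pow_iff {E M : IwasawaAlgebra p} (m : ℕ) :
    M ∈ Ideal.span ({E} : Set (IwasawaAlgebra p)) ⊔
        (Ideal.span {(PowerSeries.C (p : ℤ_[p]) : IwasawaAlgebra p)}) ^ m ↔
      ∃ a s : IwasawaAlgebra p, M = a * E + s * PowerSeries.C ((p : ℤ_[p]) ^ m) := by
  rw [span_C_p_pow_eq, Submodule.mem_sup]
  constructor
  · rintro ⟨y, hy, z, hz, hyz⟩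
    obtain ⟨a, rfl⟩ := Ideal.mem_span_singleton'.mp hy
    obtain ⟨s, rfl⟩ := Ideal.mem_span_singleton'.mp hz
    exact ⟨a, s, hyz.symm⟩
  · rintro ⟨a, s, rfl⟩
    exact ⟨a * E, Ideal.mem_span_singleton'.mpr ⟨a, rfl⟩, s * PowerSeries.C ((p : ℤ_[p]) ^ m),
      Ideal.mem_span_singleton'.mpr ⟨s, rfl⟩, rfl⟩

/-- **THE RECURSION.** Let `E ≠ 0` with `μ(E) = 0`, `u` a unit and `L = u·E + p·M + p^{m+1}·c` in
`Λ = ℤ_p⟦T⟧`. Then `(L) + (p)^{m+1} = (E) + (p)^{m+1}` if and only if `M ∈ (E) + (p)^m`.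
(⇒) the tree's «ideal ⟹ unit congruence» gives a unit `w` with `L − E·w ∈ (p^{m+1})`; reducing
`(u − w)·E ≡ 0 (mod p)` in the domain `𝔽_p⟦T⟧` with `red E ≠ 0` gives `u − w = p·t`, and cancelling `p`
in `p·(t·E + M) ∈ (p^{m+1})` yields `M ∈ (E) + (p^m)`. (⇐) if `M = a·E + s·p^m` then
`L = (u + p·a)·E + p^{m+1}·(s + c)` with `u + p·a` a unit, which is `lcongr` at level `m + 1`
(`LcongrIffUnitCongruence.lcongr_of_isUnit_of_eq_mul_add`). [cite: Skinner2016PacificMC, §3.1 (p. 192)]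
[cite: Washington1997, §7.1] -/
theorem lcongr_succ_iff_mem_span_sup_pow {L E u M c : IwasawaAlgebra p} (hE : E ≠ 0) (hμ : mu E = 0)
    (hu : IsUnit u) (m : ℕ)
    (h : L = u * E + PowerSeries.C (p : ℤ_[p]) * M + PowerSeries.C ((p : ℤ_[p]) ^ (m + 1)) * c) :
    Ideal.span ({L} : Set (IwasawaAlgebra p)) ⊔
        (Ideal.span {(PowerSeries.C (p : ℤ_[p]) : IwasawaAlgebra p)}) ^ (m + 1) =
      Ideal.span ({E} : Set (IwasawaAlgebra p)) ⊔
        (Ideal.span {(PowerSeries.C (p : ℤ_[p]) : IwasawaAlgebra p)}) ^ (m + 1) ↔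
    M ∈ Ideal.span ({E} : Set (IwasawaAlgebra p)) ⊔
        (Ideal.span {(PowerSeries.C (p : ℤ_[p]) : IwasawaAlgebra p)}) ^ m := by
  have hredE : red E ≠ 0 := red_ne_zero_of_mu_eq_zero hE hμ
  have hCsucc : (PowerSeries.C ((p : ℤ_[p]) ^ (m + 1)) : IwasawaAlgebra p) =
      PowerSeries.C (p : ℤ_[p]) * PowerSeries.C ((p : ℤ_[p]) ^ m) := by
    rw [← map_mul, ← pow_succ']
  rw [mem_span_sup_span_C_pow_iff]
  constructor
  · intro hc
    have hm : mu E < m + 1 := by omega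
    obtain ⟨w, -, hmem⟩ := exists_isUnit_and_sub_mul_mem_of_span_sup_eq hE hm hc.symm
    obtain ⟨s, hs⟩ := Ideal.mem_span_singleton'.mp hmem
    -- `(u - w) E = C p * (s C(p^m) - c C(p^m) - M)`
    have h1 : (u - w) * E = PowerSeries.C (p : ℤ_[p]) *
        ((s - c) * PowerSeries.C ((p : ℤ_[p]) ^ m) - M) := by
      have e1 : s * (PowerSeries.C (p : ℤ_[p]) * PowerSeries.C ((p : ℤ_[p]) ^ m)) = L - E * w := by
        rw [← hCsucc]; exact hs
      rw [hCsucc] at h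
      linear_combination -e1 - h
    have h2 : red (u - w) = 0 := by
      have h0 : red ((u - w) * E) = 0 := by
        rw [red_eq_zero_iff, h1]
        exact dvd_mul_right _ _
      have : red (u - w) * red E = 0 := by simpa [red, map_mul] using h0
      exact (mul_eq_zero.mp this).resolve_right hredE
    obtain ⟨t, ht⟩ := (red_eq_zero_iff _).mp h2
    -- cancel `C p`
    have h3 : PowerSeries.C (p : ℤ_[p]) *
        (t * E + M - (s - c) * PowerSeries.C ((p : ℤ_[p]) ^ m)) = 0 := by
      have e2 : (u - w) * E = PowerSeries.C (p : ℤ_[p]) * t * E := by rw [ht]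
      linear_combination h1 - e2
    have h4 : t * E + M - (s - c) * PowerSeries.C ((p : ℤ_[p]) ^ m) = 0 :=
      (mul_eq_zero.mp h3).resolve_left (IwasawaAlgebra.C_natCast_p_ne_zero p)
    exact ⟨-t, s - c, by linear_combination h4⟩
  · rintro ⟨a, s, hM⟩
    -- the unit `u + C p * a`
    have hw : IsUnit (u + PowerSeries.C (p : ℤ_[p]) * a) := by
      obtain ⟨v, rfl⟩ := hu
      have hv : (↑v + PowerSeries.C (p : ℤ_[p]) * a : IwasawaAlgebra p) =
          ↑v * (1 - (-(↑v⁻¹ * PowerSeries.C (p : ℤ_[p]) * a))) := by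
        rw [sub_neg_eq_add, mul_add, mul_one, ← mul_assoc, ← mul_assoc, Units.mul_inv, one_mul]
      rw [hv]
      refine (Units.isUnit v).mul (isUnit_one_sub_of_C_p_dvd ?_)
      exact ⟨-(↑v⁻¹ * a), by ring⟩
    refine lcongr_of_isUnit_of_eq_mul_add hw (m + 1) (c := s + c) ?_
    rw [h, hM, hCsucc]
    ring

/-- **The recursion, exact form** (`c = 0`): for `L = u·E + p·M`,
`(L) + (p)^{m+1} = (E) + (p)^{m+1}` ⟺ `M ∈ (E) + (p)^m`. [cite: Skinner2016PacificMC, §3.1 (p. 192)] -/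
theorem lcongr_succ_iff_mem_span_sup_pow' {L E u M : IwasawaAlgebra p} (hE : E ≠ 0) (hμ : mu E = 0)
    (hu : IsUnit u) (m : ℕ) (h : L = u * E + PowerSeries.C (p : ℤ_[p]) * M) :
    Ideal.span ({L} : Set (IwasawaAlgebra p)) ⊔
        (Ideal.span {(PowerSeries.C (p : ℤ_[p]) : IwasawaAlgebra p)}) ^ (m + 1) =
      Ideal.span ({E} : Set (IwasawaAlgebra p)) ⊔
        (Ideal.span {(PowerSeries.C (p : ℤ_[p]) : IwasawaAlgebra p)}) ^ (m + 1) ↔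
    M ∈ Ideal.span ({E} : Set (IwasawaAlgebra p)) ⊔
        (Ideal.span {(PowerSeries.C (p : ℤ_[p]) : IwasawaAlgebra p)}) ^ m :=
  lcongr_succ_iff_mem_span_sup_pow hE hμ hu m (c := 0) (by rw [h, mul_zero, add_zero])

/-- **Level one of the first-order term is its reduction**: `M ∈ (E) + (p)` ⟺ `red M ∈ (red E)` in
`𝔽_p⟦T⟧` — so `m = 1` of the recursion is `LcongrSecondLevel.lcongr_two_iff_red_mem_span` (p583318).
[cite: Washington1997, §7.1] -/
theorem mem_span_sup_span_C_iff_red_mem {E M : IwasawaAlgebra p} :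
    M ∈ Ideal.span ({E} : Set (IwasawaAlgebra p)) ⊔
        (Ideal.span {(PowerSeries.C (p : ℤ_[p]) : IwasawaAlgebra p)}) ^ 1 ↔
      red M ∈ Ideal.span ({red E} : Set (PowerSeries (IsLocalRing.ResidueField ℤ_[p]))) := by
  rw [mem_span_sup_span_C_pow_iff]
  constructor
  · rintro ⟨a, s, hM⟩
    refine Ideal.mem_span_singleton'.mpr ⟨red a, ?_⟩
    have hs : red (s * PowerSeries.C ((p : ℤ_[p]) ^ 1)) = 0 := by
      rw [red_eq_zero_iff, pow_one]; exact dvd_mul_left _ _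
    have : red M = red (a * E) + red (s * PowerSeries.C ((p : ℤ_[p]) ^ 1)) := by
      rw [hM]; simp [red, map_add]
    rw [this, hs, add_zero]; simp [red, map_mul]
  · intro hmem
    obtain ⟨abar, ha⟩ := Ideal.mem_span_singleton'.mp hmem
    obtain ⟨a, rfl⟩ := red_surjective (p := p) abar
    have h0 : red (M - a * E) = 0 := by
      have : red (M - a * E) = red M - red a * red E := by simp [red, map_sub, map_mul]
      rw [this, ← ha, sub_self]
    obtain ⟨s, hs⟩ := (red_eq_zero_iff _).mp h0
    refine ⟨a, s, ?_⟩
    rw [pow_one]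
    linear_combination hs

/-- **Every level from the first-order term, tower form**: for `L = u·E + p·M` (`μ(E) = 0`, `u` a
unit), `lcongr(m + 1)` for `L` relative to `E` ⟺ `∃ a, M − a·E ∈ (p^m)` — the first-order term is
congruent to a MULTIPLE of `E` modulo `p^m`. [cite: Skinner2016PacificMC, §3.1 (p. 192)] -/
theorem lcongr_succ_iff_exists_sub_mul_mem {L E u M : IwasawaAlgebra p} (hE : E ≠ 0) (hμ : mu E = 0)
    (hu : IsUnit u) (m : ℕ) (h : L = u * E + PowerSeries.C (p : ℤ_[p]) * M) :
    Ideal.span ({L} : Set (IwasawaAlgebra p)) ⊔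
        (Ideal.span {(PowerSeries.C (p : ℤ_[p]) : IwasawaAlgebra p)}) ^ (m + 1) =
      Ideal.span ({E} : Set (IwasawaAlgebra p)) ⊔
        (Ideal.span {(PowerSeries.C (p : ℤ_[p]) : IwasawaAlgebra p)}) ^ (m + 1) ↔
    ∃ a : IwasawaAlgebra p,
      M - a * E ∈ Ideal.span ({PowerSeries.C ((p : ℤ_[p]) ^ m)} : Set (IwasawaAlgebra p)) := by
  rw [lcongr_succ_iff_mem_span_sup_pow' hE hμ hu m h, mem_span_sup_span_C_pow_iff]
  constructor
  · rintro ⟨a, s, hM⟩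
    exact ⟨a, Ideal.mem_span_singleton'.mpr ⟨s, by rw [hM]; ring⟩⟩
  · rintro ⟨a, ha⟩
    obtain ⟨s, hs⟩ := Ideal.mem_span_singleton'.mp ha
    exact ⟨a, s, by linear_combination -hs⟩

/-! ## §3. The `T`-order obstruction persists at every level `≥ 2` -/

/-- **At every level `≥ 2`, `lcongr` forces `λ(E) ≤ ord_T(red M)`** (for `red M ≠ 0`): by monotonicity
(§1) level `m + 2` implies level `2`, where this is `LcongrSecondLevel.lam_le_order_red_of_lcongr_two`.
Contrapositive (MEMO-24 §1 (d)): if `E`'s line is SPECIAL (`ord_T M̄ < λ(E)`) then NO level `≥ 2` of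
`lcongr` holds for `u·E + p·M`, whatever the depth. [cite: Washington1997, §7.1] -/
theorem lam_le_order_red_of_lcongr_add_two {L E u M : IwasawaAlgebra p} (hE : E ≠ 0) (hμ : mu E = 0)
    (hu : IsUnit u) (h : L = u * E + PowerSeries.C (p : ℤ_[p]) * M) (m : ℕ)
    (hc : Ideal.span ({L} : Set (IwasawaAlgebra p)) ⊔
        (Ideal.span {(PowerSeries.C (p : ℤ_[p]) : IwasawaAlgebra p)}) ^ (m + 2) =
      Ideal.span ({E} : Set (IwasawaAlgebra p)) ⊔
        (Ideal.span {(PowerSeries.C (p : ℤ_[p]) : IwasawaAlgebra p)}) ^ (m + 2)) :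
    (lam E : ℕ∞) ≤ (red M).order :=
  lam_le_order_red_of_lcongr_two hE hμ hu h (lcongr_mono (by omega) hc)

/-- **Special line ⇒ every level `≥ 2` fails** (contrapositive of the preceding, with `ord_T(red M) < λ(E)`
as the hypothesis «`E` special relative to the first-order term»). [cite: Washington1997, §7.1] -/
theorem not_lcongr_add_two_of_order_red_lt_lam {L E u M : IwasawaAlgebra p} (hE : E ≠ 0)
    (hμ : mu E = 0) (hu : IsUnit u) (h : L = u * E + PowerSeries.C (p : ℤ_[p]) * M)
    (hlt : (red M).order < (lam E : ℕ∞)) (m : ℕ) :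
    Ideal.span ({L} : Set (IwasawaAlgebra p)) ⊔
        (Ideal.span {(PowerSeries.C (p : ℤ_[p]) : IwasawaAlgebra p)}) ^ (m + 2) ≠
      Ideal.span ({E} : Set (IwasawaAlgebra p)) ⊔
        (Ideal.span {(PowerSeries.C (p : ℤ_[p]) : IwasawaAlgebra p)}) ^ (m + 2) :=
  fun hc => (lam_le_order_red_of_lcongr_add_two hE hμ hu h m hc).not_gt hlt

end Summit.BirchSwinnertonDyer.BirchSwinnertonDyer.Theorems.LcongrHigherLevel

end
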